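import Summits.QuantumFields.YangMills.Theorems.BalabanUVNodesN15KingModelCurvatureStaggered
import Summits.QuantumFields.YangMills.Theorems.BalabanUVNodesN15KingModelCurvatureFlux
import HarnessLib

/-!
# BalabanUVNodes ∕ N15 — THE KING-MODEL RUNG (PART Ϳ-m): THE GAUSSIAN NORMALISATION AT A CURVED BACKGROUND — `det(−cΔ_U+m²) = Π_iλ_i ≥ (m² + 2c·λ(γ))^{|T|·n}` under a plaquette bound:
# the diamagnetic determinant inequality of PART Ͱ-c (`det M_U ≥ det M_1`) SHARPENED by the curvature mass; at `m² = 0` the free normalisation vanishes while the curved one is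
# `≥ (2cλ)^{|T|n} > 0`; extensive lower bound on the one-loop effective action `|T|⁻¹log det`
# (Track A, DAG node N15 = NE2; FAN-OUT v1.1 §N15 s3 «KING-MODEL RUNG … + what the curved case adds»; count-neutral)

HONEST FRAMING.  Count-neutral (cell `pub-ymgap`, seat `pub-ymgap-dag-n15-e` g46; `--supports stmt-QuantumFields-27247 --as helper` = K3ᴬ, KEY MAP v3).  King's fine covariance layer
`−cΔ_U+m²` (Ͱ-a `covLapF`) on ONE finite torus; spectral bookkeeping (Mathlib `IsHermitian.det_eq_prod_eigenvalues`) on top of Ϳ-b∕Ϳ-c∕Ϳ-e; NOT Bałaban's `G_k(U)`; NOT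
[Balaban1985BackgroundPropagators] (3.42); NOT a node discharge (N15 of record untouched); nothing continuum ∕ ℝ⁴ ∕ OS ∕ Clay.

THE RESULTS (`K` any period vector, fibre `𝕜ⁿ`, `c ≥ 0`):
* §1 `det_covLapF_eq_ofReal_prod` (`det M_U = Π_iλ_i`, a real number), `prod_eigenvalues_ge_pow` (all `λ_i ≥ κ ≥ 0` ⟹ `Π λ_i ≥ κ^{N}`), ★★★ **`pow_le_re_det_covLapF_of_plaq`** — under Ϳ-b's
  one-orientation plaquette bound with `κ = m² + 2cλ(γ) ≥ 0`: `κ^{|T×n|} ≤ Re det(−cΔ_U+m²)`; ★★ `log_re_det_covLapF_div_ge_of_plaq` (`κ > 0`: `|T×n|⁻¹·log Re det ≥ log κ` — an EXTENSIVE lower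
  bound on the Gaussian normalisation ∕ one-loop effective action at a curved background);
* §2 ★★★ **`pow_le_re_det_covLapF_fluxLink`** (`(m² + 2c(2−2cos(p′∕4)))^{|T|} ≤ det`), ★★ **`re_det_covLapF_fluxLink_massless_pos`** (`p_{ν₀} ≠ 0`, `c > 0`: the MASSLESS normalisation at
  non-zero flux is POSITIVE, `≥ (2c(2−2cos(p′∕4)))^{|T|}`, whereas King's massless `det(c(−Δ)) = 0` — Ͱ-d∕Ε-k: a zero eigenvalue), ★★ **`pow_le_re_det_covLapF_ks`** (KS field:
  `(m² + (2(d+1)−2√(d+1))c)^{|T×n|} ≤ det`).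
WHAT THE CURVED CASE ADDS (as theorems): PART Ͱ-c said the curved Gaussian normalisation is never SMALLER than King's; PART Ϳ-m says by how much at least: a factor `((m²+2cλ)∕m²)^{N}`-type
gain, infinite at `m² = 0`.
PRIOR TREE ART (by name, not restated): Ϳ-b (`eigenvalues_covLapF_ge_plaq`), Ϳ-c (`eigenvalues_covLapF_fluxLink_ge`, `fluxGap_pos`), Ϳ-e (`eigenvalues_covLapF_ks_ge`), Ͱ-a (`covLapF`, `isHermitian_covLapF`),
Mathlib (`IsHermitian.det_eq_prod_eigenvalues`, `Finset.prod_le_prod`, `Real.log_le_log`, `Real.log_pow`).  Dedup (rg at filing): basename 0 files; needles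
`det_covLapF_eq_ofReal_prod|pow_le_re_det_covLapF_of_plaq|re_det_covLapF_fluxLink_massless_pos|pow_le_re_det_covLapF_ks` 0 tree files.  Locators: [Balaban1982Higgs2] (3.38) p.591 (diamagnetic
determinant inequality, the comparison object); [DodziukMathai2006] §1 Cor 1.3; [King1986] (3.89) p.668 (the free determinant), (4.4) p.670.  0 `sorry`, 0 `def`.
-/

noncomputable section
open scoped BigOperators ComplexConjugate ComplexOrder InnerProductSpace
open Finset Matrix WithLp

namespace Summit.QuantumFields.YangMills.BalabanUVNodes.N15KingModelRung.Curvature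

open Literature.MathematicalPhysics.QuantumFieldTheory.Balaban1983to89.B5Prop11Plancherel (Tor unitVec sOf)
open Summit.QuantumFields.YangMills.BalabanUVNodes.N15KingModelRung.Covariant (covLapF fib isHermitian_covLapF)
open Summit.QuantumFields.YangMills.BalabanUVNodes.N15KingModelRung.Cover (kingPlaq fluxLink fluxLink_mem_unitaryGroup)

variable {d : ℕ} (K : Fin (d + 1) → ℕ) [hK : ∀ μ, NeZero (K μ)]
variable {𝕜 : Type*} [RCLike 𝕜] {n : Type*} [Fintype n] [DecidableEq n] {c : ℝ}

/-! ## §1 The determinant is the product of the eigenvalues; a uniform lower bound on them bounds it below -/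

/-- `det(−cΔ_U+m²) = Π_i λ_i` — a real number (Hermitian). [cite: King1986, (3.89) p.668] -/
theorem det_covLapF_eq_ofReal_prod (c m2 : ℝ) (U : Tor K × Fin (d + 1) → Matrix n n 𝕜) :
    (covLapF K c m2 U).det = (((∏ i, (isHermitian_covLapF K c m2 U).eigenvalues i : ℝ)) : 𝕜) := by
  rw [(isHermitian_covLapF K c m2 U).det_eq_prod_eigenvalues]; push_cast; rfl

omit hK [DecidableEq n] in
/-- `κ ≥ 0`, all `λ_i ≥ κ` ⟹ `κ^N ≤ Π_iλ_i`. [folklore] -/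
theorem prod_eigenvalues_ge_pow {ι : Type*} [Fintype ι] {lam : ι → ℝ} {κ : ℝ} (hκ : 0 ≤ κ) (h : ∀ i, κ ≤ lam i) : κ ^ Fintype.card ι ≤ ∏ i, lam i := by
  rw [← Finset.card_univ, ← Finset.prod_const]
  exact Finset.prod_le_prod (fun _ _ => hκ) fun i _ => h i

/-- ★★★ **THE CURVED GAUSSIAN NORMALISATION IS BOUNDED BELOW BY THE CURVATURE MASS**: under Ϳ-b's plaquette bound on one orientation (`ν₀ ≠ ν₁`, unitary `U`, any fibre) with
`κ := m² + 2c·λ(γ) ≥ 0`: `κ^{|T × n|} ≤ Re det(−cΔ_U+m²)` (`= det`, real). [cite: Balaban1982Higgs2, (3.38) p.591; DodziukMathai2006, Cor 1.3 §1; King1986, (3.89) p.668] -/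
theorem pow_le_re_det_covLapF_of_plaq (hc : 0 ≤ c) (m2 : ℝ) {U : Tor K × Fin (d + 1) → Matrix n n 𝕜} (hU : ∀ b, U b ∈ Matrix.unitaryGroup n 𝕜) {ν₀ ν₁ : Fin (d + 1)} (hν : ν₀ ≠ ν₁)
    {γ : ℝ} (hγ : ∀ x, ∀ u : EuclideanSpace 𝕜 n, RCLike.re ⟪u, Matrix.toEuclideanLin (kingPlaq K U x ν₀ ν₁) u⟫_𝕜 ≤ γ * ‖u‖ ^ 2) (hκ : 0 ≤ m2 + 2 * c * plaqGap γ) :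
    (m2 + 2 * c * plaqGap γ) ^ Fintype.card (Tor K × n) ≤ RCLike.re ((covLapF K c m2 U).det) := by
  rw [det_covLapF_eq_ofReal_prod, RCLike.ofReal_re]
  exact prod_eigenvalues_ge_pow (hκ := hκ) fun i => eigenvalues_covLapF_ge_plaq K hc m2 hU hν hγ i

/-- ★★ THE EXTENSIVE FORM: `κ > 0` ⟹ `log κ ≤ |T × n|⁻¹ · log Re det(−cΔ_U+m²)` — a volume-independent lower bound on the one-loop effective action density at a curved background.
[cite: Balaban1982Higgs2, (3.38) p.591; King1986, (3.89) p.668] -/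
theorem log_re_det_covLapF_div_ge_of_plaq (hc : 0 ≤ c) (m2 : ℝ) {U : Tor K × Fin (d + 1) → Matrix n n 𝕜} (hU : ∀ b, U b ∈ Matrix.unitaryGroup n 𝕜) {ν₀ ν₁ : Fin (d + 1)} (hν : ν₀ ≠ ν₁)
    {γ : ℝ} (hγ : ∀ x, ∀ u : EuclideanSpace 𝕜 n, RCLike.re ⟪u, Matrix.toEuclideanLin (kingPlaq K U x ν₀ ν₁) u⟫_𝕜 ≤ γ * ‖u‖ ^ 2) (hκ : 0 < m2 + 2 * c * plaqGap γ) [Nonempty n] :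
    Real.log (m2 + 2 * c * plaqGap γ) ≤ (Fintype.card (Tor K × n) : ℝ)⁻¹ * Real.log (RCLike.re ((covLapF K c m2 U).det)) := by
  have hN : 0 < (Fintype.card (Tor K × n) : ℝ) := by exact_mod_cast Fintype.card_pos
  have h := pow_le_re_det_covLapF_of_plaq K hc m2 hU hν hγ hκ.le
  have hlog := Real.log_le_log (pow_pos hκ _) h
  rw [Real.log_pow] at hlog
  rw [le_inv_mul_iff₀ hN]
  linarith

/-! ## §2 The constant-flux and Kogut–Susskind fields -/

/-- ★★★ **AT THE CONSTANT-FLUX FIELD**: `(m² + 2c(2−2cos(p′_{ν₀}∕4)))^{|T|} ≤ det(−cΔ_U+m²)` whenever the base is `≥ 0` (`ν₀ ≠ ν₁`, `c ≥ 0`). [cite: Balaban1982Higgs2, (3.38) p.591; King1986, (3.89) p.668] -/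
theorem pow_le_re_det_covLapF_fluxLink (hc : 0 ≤ c) (m2 : ℝ) (p : Tor K) {ν₀ ν₁ : Fin (d + 1)} (hν : ν₀ ≠ ν₁) (hκ : 0 ≤ m2 + 2 * c * (2 - 2 * Real.cos (sOf K p ν₀ / 4))) :
    (m2 + 2 * c * (2 - 2 * Real.cos (sOf K p ν₀ / 4))) ^ Fintype.card (Tor K × Unit) ≤ RCLike.re ((covLapF K c m2 (fluxLink K p ν₁)).det) := by
  rw [det_covLapF_eq_ofReal_prod, RCLike.ofReal_re]
  exact prod_eigenvalues_ge_pow (hκ := hκ) fun i => eigenvalues_covLapF_fluxLink_ge K hc m2 p hν i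

/-- ★★ **THE MASSLESS NORMALISATION AT NON-ZERO FLUX IS POSITIVE**: `p_{ν₀} ≠ 0`, `c > 0` ⟹ `0 < (2c(2−2cos(p′∕4)))^{|T|} ≤ det(−cΔ_U)` — whereas King's massless free determinant
`det(c(−Δ))` vanishes (zero mode of the constants, Ͱ-d). [cite: Balaban1982Higgs2, (3.38) p.591; DodziukMathai2006, Cor 1.3 §1] -/
theorem re_det_covLapF_fluxLink_massless_pos (hc : 0 < c) {p : Tor K} {ν₀ ν₁ : Fin (d + 1)} (hν : ν₀ ≠ ν₁) (hp : p ν₀ ≠ 0) :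
    0 < RCLike.re ((covLapF K c 0 (fluxLink K p ν₁)).det) := by
  have hg : 0 < 0 + 2 * c * (2 - 2 * Real.cos (sOf K p ν₀ / 4)) := by rw [zero_add]; exact mul_pos (mul_pos two_pos hc) (fluxGap_pos K hp)
  exact lt_of_lt_of_le (pow_pos hg _) (pow_le_re_det_covLapF_fluxLink K hc.le 0 p hν hg.le)

/-- ★★ **AT THE KOGUT–SUSSKIND FIELD** (all `K` even, `c ≥ 0`, any fibre): `(m² + (2(d+1)−2√(d+1))c)^{|T × n|} ≤ Re det(−cΔ_U+m²)` whenever the base is `≥ 0`.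
[cite: Balaban1982Higgs2, (3.38) p.591; King1986, (3.89) p.668] -/
theorem pow_le_re_det_covLapF_ks (hc : 0 ≤ c) (m2 : ℝ) (hK2 : ∀ μ, Even (K μ)) (hκ : 0 ≤ m2 + (2 * ((d : ℝ) + 1) - 2 * Real.sqrt ((d : ℝ) + 1)) * c) :
    (m2 + (2 * ((d : ℝ) + 1) - 2 * Real.sqrt ((d : ℝ) + 1)) * c) ^ Fintype.card (Tor K × n) ≤ RCLike.re ((covLapF K c m2 (ksLink K (n := n) (𝕜 := 𝕜))).det) := by
  rw [det_covLapF_eq_ofReal_prod, RCLike.ofReal_re]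
  exact prod_eigenvalues_ge_pow (hκ := hκ) fun i => eigenvalues_covLapF_ks_ge K hc m2 hK2 i

end Summit.QuantumFields.YangMills.BalabanUVNodes.N15KingModelRung.Curvature

end
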